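import Mathlib
import HarnessLib
import Summits.QuantumFields.YangMills.Theorems.U1DipoleHelicityOptimalTestForm
import Summits.QuantumFields.YangMills.Theorems.U1DipoleHelicitySecondMomentUpper
import Summits.QuantumFields.YangMills.Theses.U1DipoleHelicity

/-!
# `WilsonU1PlaquetteSecondMomentD4` — lattice equipartition of the plaquette angle of weak-coupling
# Wilson `U(1)₄`, proved: `|2β⟨sin²θ_p⟩_μ − 1| ≤ ε` for every infinite-volume limit state

Route `U1DipoleHelicity` (LINE 4 of the ideator cell ym-idea-2; an abelian COMPARISON line onto the
node `Theorems.U1HelicityGapD4`, not a rung of `YangMills`), crux item stmt-QuantumFields-25881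
`Summit.QuantumFields.YangMills.Theses.U1DipoleHelicity.WilsonU1PlaquetteSecondMomentD4`: for every
`ε > 0` there is `β₁` such that every infinite-volume torus limit state `μ` of Wilson `U(1)₄` at
`β > β₁` has `|2β·⟨sin²θ_{(0;0,1)}⟩_μ − 1| ≤ ε` (`U1Helicity.plaqCorr μ 0 0 1 = ⟨sin²θ_{(0;0,1)}⟩_μ`).

The two halves, both uniform over ALL torus sides (no reflection positivity, no parity restriction)
and over all (non-unique) limit states:
* UPPER (`U1DipoleHelicitySecondMomentUpper.wilsonU1PlaquetteSecondMoment_upper`):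
  `sin²θ ≤ 2(1 − cos θ)` and the tree's one-point theorem at weak coupling
  `SoloBlind.weakCoupling_singlePlaquette` (Chatterjee's leading free-energy term + convexity:
  `β⟨1 − cos θ_p⟩ → 1/4`);
* LOWER (`U1DipoleHelicityOptimalTestForm.wilsonU1PlaquetteSecondMoment_lower`): the lattice
  Bogoliubov inequality (two `U(1)` Ward identities + Cauchy–Schwarz, `U1DipoleHelicityWardReal`)
  evaluated on the optimal test form `d*(G̃ ⊗ e₀∧e₁)` built from the zero-mode-free torus Green
  function, whose charge-to-norm ratio is the diagonal `(1 − L⁻⁴)/2` of the projection onto exact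
  2-forms (`U1DipoleHelicityTorusGreenLaplacian`, `U1DipoleHelicityTorusSBP`), times `⟨cos θ_p⟩ → 1`.

Physically: the field strength of the weak-coupling Wilson photon is equipartitioned, `β⟨F₀₁²⟩ → 1/2`
(three physical link modes per site shared by six plaquettes), exactly as for the free lattice Maxwell
field (`K(0) = 1/2`).  Nothing here bears on the Yang–Mills mass gap: the line is the abelian
comparison statement.
-/

noncomputable section

namespace Summit.QuantumFields.YangMills.Theorems.U1DipoleHelicity

open MeasureTheory Filter Topology
open Literature.MathematicalPhysics.QuantumLattice Literature.MathematicalPhysics.QuantumFieldTheory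
open Summit.QuantumFields.YangMills.Theorems.U1Helicity

/-- **Crux item stmt-QuantumFields-25881 `WilsonU1PlaquetteSecondMomentD4`, proved**: lattice
equipartition of the plaquette angle, `|2β⟨sin²θ_{(0;0,1)}⟩_μ − 1| ≤ ε` for every weak-coupling
infinite-volume limit state of Wilson `U(1)₄` (upper half `wilsonU1PlaquetteSecondMoment_upper`, lower
half `wilsonU1PlaquetteSecondMoment_lower`). [folklore] -/
theorem wilsonU1PlaquetteSecondMomentD4_proof :
    Summit.QuantumFields.YangMills.Theses.U1DipoleHelicity.WilsonU1PlaquetteSecondMomentD4 := by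
  intro ε hε
  obtain ⟨β₁, h₁⟩ := wilsonU1PlaquetteSecondMoment_upper ε hε
  obtain ⟨β₂, h₂⟩ := wilsonU1PlaquetteSecondMoment_lower ε hε
  refine ⟨max β₁ β₂, fun β hb μ hμ => ?_⟩
  have hu := h₁ β (lt_of_le_of_lt (le_max_left _ _) hb) μ hμ
  have hl := h₂ β (lt_of_le_of_lt (le_max_right _ _) hb) μ hμ
  rw [abs_le]
  constructor <;> linarith

end Summit.QuantumFields.YangMills.Theorems.U1DipoleHelicity
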